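import Literature.NumberTheory.EllipticCurves.BSDQuadraticDescentCasselsPairingProofs
import Mathlib.Algebra.Module.CharacterModule
import Mathlib.Algebra.Exact.Basic
import HarnessLib

/-!
# Route `SignedLowerHalves`, crux L `SmallImageLowerHalfBothSigns` (stmt-BirchSwinnertonDyer-23599), line `rtt_w3` v13 — E2, LEAD:
# PONTRYAGIN DUALITY TURNS QUASI-ISOMORPHISMS INTO QUASI-ISOMORPHISMS (finite kernel ↔ finite cokernel)

WHY (BRIEF-E2 rev 3 §3 row `X' ↔ Dψ.X`, `Lines/rtt_w3-BRIEF-E2-g9.md`). The E2 glues `charRoad_E2_of_parts` / `charRoad_E2_of_localisation`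
(p775611, p776213) conclude with `λ(X')`; the stub's module `Dψ.X` is the PONTRYAGIN DUAL (`SignedTransportDualDataSat.toDual`, a bijection onto
`Sel →+ AddCircle (1 : ℚ)`) of the saturated transported signed Selmer group over `K^cyc_∞`, while `X'` (row D2-seq) is, up to the same duality, a
Selmer-type group over the two-variable tower `L_∞ = K(𝔣p^∞)`. The comparison is made on the DISCRETE side — restriction / inflation–restriction
`Sel(K^cyc_∞) → Sel(L_∞)^{Ω'}` has FINITE kernel and cokernel — and must be transported to the duals, where `λ` is read
(`lambdaInvariant_eq_of_finite_ker_coker`, p776013). This file is that transport, for arbitrary abelian groups and the duals `A →+ ℚ/ℤ`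
(`AddCircle (1 : ℚ)`, as in the tree's dual data), the dual of `f : A →+ B` being precomposition `AddMonoidHom.compHom' f`:
* (reused) `Literature.NumberTheory.EllipticCurves.finite_addMonoidHom_addCircle` — the character group of a finite group is finite;
* `exact_compHom'_addCircle` — `Hom(−, ℚ/ℤ)` is exact in the middle (`ℚ/ℤ` is injective: `CharacterModule.dual_surjective_of_injective`);
* ★ `finite_ker_compHom'_addCircle` / `finite_quotient_range_compHom'_addCircle` — for `f : A →+ B` with finite COKERNEL (resp. KERNEL), the dual map
  `f⋆ : (B →+ ℚ/ℤ) →+ (A →+ ℚ/ℤ)` has finite KERNEL (resp. COKERNEL).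
THEOREMS ONLY (group algebra); nothing about `BirchSwinnertonDyer`, crux L or E2 is proved here. [cite: Washington1997, §13.2] [folklore]
-/

set_option linter.dupNamespace false -- D-0017: single-problem summit, the namespace repeats the problem name by design
set_option autoImplicit false

noncomputable section

namespace Summit.BirchSwinnertonDyer.BirchSwinnertonDyer.Theorems.SmallImageRttCharRoad

universe u v w

/-- **`Hom(−, ℚ/ℤ)` is exact**: if `A →ᶠ B →ᵍ C` is exact then so is `(C →+ ℚ/ℤ) →^{g⋆} (B →+ ℚ/ℤ) →^{f⋆} (A →+ ℚ/ℤ)` — a character of `B`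
vanishing on `f(A) = ker g` descends to `B/ker g ≅ g(B) ⊆ C` and extends to `C` by the injectivity of `ℚ/ℤ`
(`CharacterModule.dual_surjective_of_injective`). [folklore] -/
theorem exact_compHom'_addCircle {A : Type u} {B : Type v} {C : Type w} [AddCommGroup A] [AddCommGroup B] [AddCommGroup C]
    (f : A →+ B) (g : B →+ C) (hfg : Function.Exact f g) :
    Function.Exact (AddMonoidHom.compHom' (P := AddCircle (1 : ℚ)) g) (AddMonoidHom.compHom' (P := AddCircle (1 : ℚ)) f) := by
  intro χ
  constructor
  · intro hχ
    -- `χ` vanishes on `range f = ker g`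
    have hvan : ∀ b ∈ g.ker, χ b = 0 := fun b hb ↦ by
      obtain ⟨a, rfl⟩ := (hfg b).mp hb
      exact DFunLike.congr_fun hχ a
    -- descend to `B ⧸ ker g ≃ range g`, then extend to `C`
    let χbar : B ⧸ g.ker →+ AddCircle (1 : ℚ) := QuotientAddGroup.lift g.ker χ fun b hb ↦ hvan b hb
    let χ' : CharacterModule g.range := χbar.comp (QuotientAddGroup.quotientKerEquivRange g).symm.toAddMonoidHom
    obtain ⟨ψ, hψ⟩ := CharacterModule.dual_surjective_of_injective g.range.subtype.toIntLinearMap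
      (fun x y h ↦ Subtype.ext h) χ'
    refine ⟨ψ, AddMonoidHom.ext fun b ↦ ?_⟩
    have h2 : (ψ : C →+ AddCircle (1 : ℚ)) (g b) = χ' ⟨g b, ⟨b, rfl⟩⟩ := by
      rw [← hψ]
      rfl
    change (ψ : C →+ AddCircle (1 : ℚ)) (g b) = χ b
    rw [h2]
    change χbar ((QuotientAddGroup.quotientKerEquivRange g).symm ⟨g b, ⟨b, rfl⟩⟩) = χ b
    have h3 : (QuotientAddGroup.quotientKerEquivRange g).symm ⟨g b, ⟨b, rfl⟩⟩ = (b : B ⧸ g.ker) := by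
      rw [AddEquiv.symm_apply_eq]
      rfl
    rw [h3]
    rfl
  · rintro ⟨ψ, rfl⟩
    refine AddMonoidHom.ext fun a ↦ ?_
    change (ψ : C →+ AddCircle (1 : ℚ)) (g (f a)) = 0
    rw [(hfg (f a)).mpr ⟨a, rfl⟩, map_zero]

/-- **Finite cokernel ⟹ finite kernel of the dual**: for `f : A →+ B` with `B/f(A)` finite, `ker(f⋆)` — the characters of `B` vanishing on `f(A)`,
i.e. the characters of `B/f(A)` — is finite. [folklore] -/
theorem finite_ker_compHom'_addCircle {A : Type u} {B : Type v} [AddCommGroup A] [AddCommGroup B] (f : A →+ B)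
    (hcoker : Finite (B ⧸ f.range)) : Finite (AddMonoidHom.compHom' (P := AddCircle (1 : ℚ)) f).ker := by
  haveI := Literature.NumberTheory.EllipticCurves.finite_addMonoidHom_addCircle (B ⧸ f.range)
  -- `χ ↦ χ̄ : B ⧸ range f →+ ℚ/ℤ` is injective on `ker f⋆`
  have hvan : ∀ χ : (AddMonoidHom.compHom' (P := AddCircle (1 : ℚ)) f).ker, ∀ b ∈ f.range, (χ : B →+ AddCircle (1 : ℚ)) b = 0 := by
    rintro ⟨χ, hχ⟩ b ⟨a, rfl⟩
    exact DFunLike.congr_fun (AddMonoidHom.mem_ker.mp hχ) a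
  refine Finite.of_injective (fun χ : (AddMonoidHom.compHom' (P := AddCircle (1 : ℚ)) f).ker ↦
    QuotientAddGroup.lift f.range (χ : B →+ AddCircle (1 : ℚ)) (hvan χ)) fun χ ψ h ↦ ?_
  refine Subtype.ext (AddMonoidHom.ext fun b ↦ ?_)
  have hb := DFunLike.congr_fun h (b : B ⧸ f.range)
  simpa only [QuotientAddGroup.lift_mk] using hb

/-- **Finite kernel ⟹ finite cokernel of the dual**: for `f : A →+ B` with `ker f` finite, `(A →+ ℚ/ℤ)/f⋆(B →+ ℚ/ℤ)` is finite — by exactness of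
`Hom(−, ℚ/ℤ)` on `ker f ↪ A → B`, `f⋆(B →+ ℚ/ℤ)` is the kernel of the restriction `(A →+ ℚ/ℤ) → (ker f →+ ℚ/ℤ)`, so the cokernel embeds into the
finite `ker f →+ ℚ/ℤ`. [folklore] -/
theorem finite_quotient_range_compHom'_addCircle {A : Type u} {B : Type v} [AddCommGroup A] [AddCommGroup B] (f : A →+ B)
    (hker : Finite f.ker) : Finite ((A →+ AddCircle (1 : ℚ)) ⧸ (AddMonoidHom.compHom' (P := AddCircle (1 : ℚ)) f).range) := by
  haveI := Literature.NumberTheory.EllipticCurves.finite_addMonoidHom_addCircle f.ker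
  have hexact : Function.Exact (AddMonoidHom.compHom' (P := AddCircle (1 : ℚ)) f)
      (AddMonoidHom.compHom' (P := AddCircle (1 : ℚ)) f.ker.subtype) :=
    exact_compHom'_addCircle f.ker.subtype f fun a ↦
      ⟨fun ha ↦ ⟨⟨a, ha⟩, rfl⟩, by rintro ⟨x, rfl⟩; exact x.2⟩
  rw [← hexact.addMonoidHom_ker_eq]
  exact Finite.of_equiv _ (QuotientAddGroup.quotientKerEquivRange
    (AddMonoidHom.compHom' (P := AddCircle (1 : ℚ)) f.ker.subtype)).toEquiv.symm

/-- **`coker(f⋆) ≅ (ker f)⋆`** (Pontryagin): for `f : A →+ B`, the cokernel of the dual map `f⋆ : (B →+ ℚ/ℤ) → (A →+ ℚ/ℤ)` is canonically the character group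
of `ker f` — `f⋆(B →+ ℚ/ℤ) = ker((ker f ↪ A)⋆)` by exactness of `Hom(−, ℚ/ℤ)`, and `(ker f ↪ A)⋆` is onto by the injectivity of `ℚ/ℤ`. (Use, BRIEF-E2 rev 3.1 §2:
`coker(gX) = coker(loc_v^∨) ≅ (ker loc_v)^∨ = Sel_str^∨`.) [cite: Washington1997, §13.2] [folklore] -/
theorem nonempty_quotient_range_compHom'_addEquiv_ker {A : Type u} {B : Type v} [AddCommGroup A] [AddCommGroup B] (f : A →+ B) :
    Nonempty (((A →+ AddCircle (1 : ℚ)) ⧸ (AddMonoidHom.compHom' (P := AddCircle (1 : ℚ)) f).range) ≃+ (f.ker →+ AddCircle (1 : ℚ))) := by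
  have hexact : Function.Exact (AddMonoidHom.compHom' (P := AddCircle (1 : ℚ)) f)
      (AddMonoidHom.compHom' (P := AddCircle (1 : ℚ)) f.ker.subtype) :=
    exact_compHom'_addCircle f.ker.subtype f fun a ↦
      ⟨fun ha ↦ ⟨⟨a, ha⟩, rfl⟩, by rintro ⟨x, rfl⟩; exact x.2⟩
  have hsurj : Function.Surjective (AddMonoidHom.compHom' (P := AddCircle (1 : ℚ)) f.ker.subtype) := fun χ ↦ by
    obtain ⟨ψ, hψ⟩ := CharacterModule.dual_surjective_of_injective f.ker.subtype.toIntLinearMap (fun x y h ↦ Subtype.ext h) χ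
    exact ⟨ψ, hψ⟩
  exact ⟨(QuotientAddGroup.quotientAddEquivOfEq hexact.addMonoidHom_ker_eq.symm).trans
    (QuotientAddGroup.quotientKerEquivOfSurjective _ hsurj)⟩

end Summit.BirchSwinnertonDyer.BirchSwinnertonDyer.Theorems.SmallImageRttCharRoad

end
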